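import Summits.QuantumFields.YangMills.Theorems.UnitScaleTiltHalvingP1FlatCoreFrameLinTowerSum
import HarnessLib

/-!
# The effective-gauge tower in log coordinates — LOCAL form of the `k`-uniform size row (J-N05♭ `core′`, induction brick F2-local)

Sub-problem `YangMills` of summit `QuantumFields`; route `UnitScaleTilt`, line H = `BirthV10.stub_halvingStep`, pillar P1♭ `core′`
(LEAD-H T2♭-PLAN v1.1; rulings L-3/L-4/L-5).  Helper file (`--supports stmt-QuantumFields-19200 --as helper`); it closes no item.
HONEST LABEL: YM₃ on `T³` is rung R3 of the ladder, NOT the Clay problem; nothing here is a mass-gap statement.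

## What this file adds

✓`P1FlatCoreFrameLinTowerSum.exp_mlog_and_norm_mlog_effGauge_sub_siteAvgIter_le` asks its hypotheses (`‖l₀‖ ≤ a`, stairs, linear
oscillations) at EVERY site of EVERY level.  The family contraction's rows (1.120)/(1.121) (✓`B8SectEKLevelFamily`, `hC121`) are LOCAL:
the data are controlled only on the (1.120)-box of the tower under the evaluation site, and the value `κ_k(y₀)` only depends on the tower
under `y₀` (each step reads the centre and the stair ends of the block).  This file re-runs the induction on a user-supplied family of site
sets `S j ⊆ T^{(j)}` closed under «centre and stair ends of a block in `S (j+1)` lie in `S j`» (e.g. the sites under `y₀`, or under a box):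
§1 the one-block step with POINTWISE hypotheses (`κ_i = e^{l}` only at the centre and the stair ends — all that ✓F2a's proof uses);
§2 `Q′` preserves sup bounds on `S`; §3 ★★★ `exp_mlog_and_norm_mlog_effGauge_sub_siteAvgIter_le_local` and the top row
`‖log κ_k(y) − (Q′_k l₀)(y)‖ ≤ 640·(a + δ + 5ω)·ω` for `y ∈ S k`, hypotheses on `S` only, constant independent of `k`.

[cite: Balaban1985RegularSpaces, Sect. E (1.120)-(1.121) pp.95-96; Balaban1985Averaging, (97)-(100) p.32, (110) p.34]
-/

noncomputable section

open NormedSpace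
open Literature.MathematicalPhysics.QuantumFieldTheory.Balaban1983to89
open Literature.Analysis.Complex (mem_eball_expSeries_radius)
open T4Continuum BlockAveraging ExpMeanLog MatrixLog
open B10Eq27TorusAxialLog (holT gaugeActT)
open B7TransferAnalyticMean (meanCLM meanCLM_apply norm_meanCLM_apply_le)
open B12Membership313II (bchLog exp_bchLog norm_bchRem_sub_bchRem_le norm_expMul_sub_one_lt_one)
open BlockAveragingEMLAnalyticMean (eml_eq_exp_meanCLM)
open B7Prop1Explicit (units_val_inv_eq_exp_neg)
open LatticeFieldCalculus (siteAvg siteAvgIter)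
open Summit.QuantumFields.YangMills.Theorems.Prop8ChartDoubleBar (vframeU coe_vframeU dbarIterU)
open Summit.QuantumFields.YangMills.Theorems.P1FlatCoreFrameLinBCH (meanCLM_const norm_meanCLM_le_of_forall_le)
open Summit.QuantumFields.YangMills.Theorems.P1FlatCoreFrameLin (coe_vframeU_eq_exp_meanCLM meanCLM_stairEnd_eq_siteAvg)
open Summit.QuantumFields.YangMills.Theorems.P1FlatCoreFrameLinTower (effGauge_step_eq_eml_G)
open Summit.QuantumFields.YangMills.Theorems.P1FlatCoreFrameLinOsc (norm_bchLog_neg_sub_le norm_bchLog_le_two_mul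
  norm_bchLog_bchLog_le norm_bchLog_step_sub_mean_le)
open Summit.QuantumFields.YangMills.Theorems.P1FlatCoreFrameLinTowerSum (norm_siteAvg_le norm_siteAvg_sub_siteAvg_le step_arith)

namespace Summit.QuantumFields.YangMills.Theorems.P1FlatCoreFrameLinLocal

variable {𝔸 : Type*} [NormedRing 𝔸] [NormedAlgebra ℂ 𝔸] [CompleteSpace 𝔸]
variable {P : Params}

/-! ## §1 The one-block step with pointwise hypotheses -/

section Step

/-- **★★ ONE STEP AS ONE EXPONENTIAL — POINTWISE HYPOTHESES** (✓`P1FlatCoreFrameLinOsc.exists_effGauge_succ_eq_exp` with `κ_i = e^{l}` assumed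
only AT the centre `ȳ` and the stair ends of the block of `y`, which is all its proof uses — the form a LOCAL tower needs): for the effective gauges `κ`
of the double-bar tower of a level-`0` field `W` (recursion `κ_{i+1}(y) = v(X_i^{κ_i})(y)⁻¹ κ_i(ȳ) v(X_i)(y)`, `X_i = U̿^{(i)}W`, ✓`exists_effGauge`),
`κ_i = exp ∘ l` with `‖l‖ ≤ a` at the centre and the stair ends of the block of `y`, oscillation `‖l(x_idx) − l(ȳ)‖ ≤ m`, stairs within `δ` of `1`,
`2a + 4δ + 8m ≤ 1/16`:  `κ_{i+1}(y) = e^{Λ}`, `‖Λ − siteAvg l y‖ ≤ 160·(a + δ + m)·m`, `‖Λ‖ ≤ a + 5m` — error ∝ the OSCILLATION `m`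
(compare ✓`norm_mlog_effGaugeStep_sub_siteAvg_le`: `700(δ+ℓ)ℓ`).  Exact step ✓`effGauge_step_eq_eml_G`; §3 for the outer products, §2 for `G`.
[cite: Balaban1985RegularSpaces, Sect. E (1.120)-(1.121) pp.95-96; Balaban1985Averaging, (97)-(100) p.32, (110) p.34] -/
theorem exists_effGauge_succ_eq_exp_pt [Nonempty (Idx P)] (W : GaugeField P 0 𝔸ˣ) (κ : (i : ℕ) → GaugeTransf P i 𝔸ˣ)
    (hs : ∀ (i : ℕ) (y : Site P (i + 1)),
      κ (i + 1) y = (vframeU (gaugeActT (κ i) (dbarIterU i W)) y)⁻¹ * κ i (emb y) * vframeU (dbarIterU i W) y)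
    (i : ℕ) (y : Site P (i + 1)) (l : Site P i → 𝔸) (hκc : ((κ i (emb y) : 𝔸ˣ) : 𝔸) = exp (l (emb y)))
    (hκs : ∀ idx : Idx P, ((κ i (walkEnd (emb y) (stairWord idx.2.1 (off idx.1))) : 𝔸ˣ) : 𝔸) =
      exp (l (walkEnd (emb y) (stairWord idx.2.1 (off idx.1))))) {δ a m : ℝ} (hδ : 0 ≤ δ)
    (hH : ∀ idx : Idx P, ‖((holT (dbarIterU i W) (emb y) (stairWord idx.2.1 (off idx.1)) : 𝔸ˣ) : 𝔸) - 1‖ ≤ δ)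
    (ha : ‖l (emb y)‖ ≤ a) (hb : ∀ idx : Idx P, ‖l (walkEnd (emb y) (stairWord idx.2.1 (off idx.1)))‖ ≤ a)
    (hm : ∀ idx : Idx P, ‖l (walkEnd (emb y) (stairWord idx.2.1 (off idx.1))) - l (emb y)‖ ≤ m)
    (hr : 2 * a + 4 * δ + 8 * m ≤ 1 / 16) :
    ∃ Λ : 𝔸, ((κ (i + 1) y : 𝔸ˣ) : 𝔸) = exp Λ ∧ ‖Λ - siteAvg l y‖ ≤ 160 * (a + δ + m) * m ∧ ‖Λ‖ ≤ a + 5 * m := by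
  have ha0 : 0 ≤ a := (norm_nonneg _).trans ha
  have hm0 : 0 ≤ m := (norm_nonneg _).trans (hm (Classical.arbitrary (Idx P)))
  -- letters: `A` centre log, `B idx` stair-end logs, `Hl idx` stair logs, `S idx` relative logs
  set A : 𝔸 := l (emb y) with hA
  have hBA : ∀ idx : Idx P, (((κ i (walkEnd (emb y) (stairWord idx.2.1 (off idx.1))))⁻¹ * κ i (emb y) : 𝔸ˣ) : 𝔸) =
      exp (-(l (walkEnd (emb y) (stairWord idx.2.1 (off idx.1))))) * exp A := fun idx => by
    rw [Units.val_mul, units_val_inv_eq_exp_neg (hκs idx), hκc]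
  have hS6 : ∀ idx : Idx P, ‖bchLog (-(l (walkEnd (emb y) (stairWord idx.2.1 (off idx.1))))) A -
      (A - l (walkEnd (emb y) (stairWord idx.2.1 (off idx.1))))‖ ≤ 6 * a * m := fun idx =>
    (norm_bchLog_neg_sub_le (hb idx) ha (by linarith)).trans
      (mul_le_mul_of_nonneg_left (by rw [norm_sub_rev]; exact hm idx) (by positivity))
  have hSn : ∀ idx : Idx P, ‖bchLog (-(l (walkEnd (emb y) (stairWord idx.2.1 (off idx.1))))) A‖ ≤ 2 * m := fun idx => by
    have h6 : 6 * a * m ≤ m := by nlinarith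
    have hd : ‖A - l (walkEnd (emb y) (stairWord idx.2.1 (off idx.1)))‖ ≤ m := by rw [norm_sub_rev]; exact hm idx
    calc _ = ‖(bchLog (-(l (walkEnd (emb y) (stairWord idx.2.1 (off idx.1))))) A -
          (A - l (walkEnd (emb y) (stairWord idx.2.1 (off idx.1))))) + (A - l (walkEnd (emb y) (stairWord idx.2.1 (off idx.1))))‖ := by
            rw [sub_add_cancel]
      _ ≤ 6 * a * m + m := (norm_add_le _ _).trans (add_le_add (hS6 idx) hd)
      _ ≤ 2 * m := by linarith
  have hHn : ∀ idx : Idx P, ‖mlog ((holT (dbarIterU i W) (emb y) (stairWord idx.2.1 (off idx.1)) : 𝔸ˣ) : 𝔸)‖ ≤ 2 * δ := fun idx =>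
    (norm_mlog_le_two_mul ((hH idx).trans (by linarith))).trans (by linarith [hH idx])
  set Sb : 𝔸 := meanCLM (Idx P) 𝔸 fun idx : Idx P => bchLog (-(l (walkEnd (emb y) (stairWord idx.2.1 (off idx.1))))) A with hSb
  set M : 𝔸 := meanCLM (Idx P) 𝔸 fun idx : Idx P =>
      bchLog (mlog ((holT (dbarIterU i W) (emb y) (stairWord idx.2.1 (off idx.1)) : 𝔸ˣ) : 𝔸))
        (bchLog (-(l (walkEnd (emb y) (stairWord idx.2.1 (off idx.1))))) A) with hM
  set Hb : 𝔸 := meanCLM (Idx P) 𝔸 fun idx : Idx P => mlog ((holT (dbarIterU i W) (emb y) (stairWord idx.2.1 (off idx.1)) : 𝔸ˣ) : 𝔸)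
    with hHb
  have hSbn : ‖Sb‖ ≤ 2 * m := norm_meanCLM_le_of_forall_le _ (by positivity) hSn
  have hHbn : ‖Hb‖ ≤ 2 * δ := norm_meanCLM_le_of_forall_le _ (by positivity) hHn
  have hMn : ‖M‖ ≤ 2 * (2 * δ + 2 * m) :=
    norm_meanCLM_le_of_forall_le _ (by positivity) fun idx => norm_bchLog_le_two_mul (hHn idx) (hSn idx) (by linarith)
  have hemlS : eml (fun idx : Idx P => (((κ i (walkEnd (emb y) (stairWord idx.2.1 (off idx.1))))⁻¹ * κ i (emb y) : 𝔸ˣ) : 𝔸)) =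
      exp Sb := by
    rw [eml_eq_exp_meanCLM, hSb]
    congr 1; congr 1; funext idx
    rw [hBA idx]; rfl
  have hemlHS : eml (fun idx : Idx P => ((holT (dbarIterU i W) (emb y) (stairWord idx.2.1 (off idx.1)) : 𝔸ˣ) : 𝔸) *
      (((κ i (walkEnd (emb y) (stairWord idx.2.1 (off idx.1))))⁻¹ * κ i (emb y) : 𝔸ˣ) : 𝔸)) = exp M := by
    rw [eml_eq_exp_meanCLM, hM]
    congr 1; congr 1; funext idx
    have h1 : ‖((holT (dbarIterU i W) (emb y) (stairWord idx.2.1 (off idx.1)) : 𝔸ˣ) : 𝔸) - 1‖ < 1 := (hH idx).trans_lt (by linarith)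
    have h2 : ‖-(l (walkEnd (emb y) (stairWord idx.2.1 (off idx.1))))‖ + ‖A‖ ≤ 1 / 4 := by rw [norm_neg]; linarith [hb idx]
    rw [hBA idx, ← exp_bchLog (norm_expMul_sub_one_lt_one h2)]
    conv_lhs => rw [← exp_mlog h1]
    rfl
  have hv : ((vframeU (dbarIterU i W) y : 𝔸ˣ) : 𝔸) = exp Hb := by rw [hHb]; exact coe_vframeU_eq_exp_meanCLM _ y
  have hU : (((isUnit_eml (fun idx : Idx P =>
      (((κ i (walkEnd (emb y) (stairWord idx.2.1 (off idx.1))))⁻¹ * κ i (emb y) : 𝔸ˣ) : 𝔸))).unit : 𝔸ˣ) : 𝔸) = exp Sb := by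
    rw [IsUnit.unit_spec, hemlS]
  have hV : (((isUnit_eml (fun idx : Idx P => ((holT (dbarIterU i W) (emb y) (stairWord idx.2.1 (off idx.1)) : 𝔸ˣ) : 𝔸) *
      (((κ i (walkEnd (emb y) (stairWord idx.2.1 (off idx.1))))⁻¹ * κ i (emb y) : 𝔸ˣ) : 𝔸))).unit : 𝔸ˣ) : 𝔸) = exp M := by
    rw [IsUnit.unit_spec, hemlHS]
  -- the step as a product of exponentials, then as a two-fold BCH logarithm
  have hkey : ((κ (i + 1) y : 𝔸ˣ) : 𝔸) = exp A * exp (-Sb) * (exp Sb * exp (-M) * exp Hb) := by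
    rw [effGauge_step_eq_eml_G W κ hs i y, Units.val_mul, Units.val_mul, Units.val_mul, Units.val_mul,
      units_val_inv_eq_exp_neg hU, units_val_inv_eq_exp_neg hV, hU, hv, hκc]
  have h1 : ‖Sb‖ + ‖-M‖ ≤ 1 / 4 := by rw [norm_neg]; linarith
  have hTn : ‖bchLog Sb (-M)‖ ≤ 2 * (2 * m + 2 * (2 * δ + 2 * m)) :=
    norm_bchLog_le_two_mul hSbn (by rw [norm_neg]; exact hMn) (by linarith)
  have h2 : ‖bchLog Sb (-M)‖ + ‖Hb‖ ≤ 1 / 4 := by linarith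
  have h3 : ‖A‖ + ‖-Sb‖ ≤ 1 / 4 := by rw [norm_neg]; linarith
  -- the `W`-factor (§2) and the step (§3)
  have hG : ‖bchLog (bchLog Sb (-M)) Hb‖ ≤ 9 * (2 * δ + 2 * (2 * m)) * (2 * m) := by
    rw [hSb, hM, hHb]
    exact norm_bchLog_bchLog_le (ι := Idx P)
      (fun idx : Idx P => mlog ((holT (dbarIterU i W) (emb y) (stairWord idx.2.1 (off idx.1)) : 𝔸ˣ) : 𝔸))
      (fun idx : Idx P => bchLog (-(l (walkEnd (emb y) (stairWord idx.2.1 (off idx.1))))) A) hHn hSn (by linarith)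
  have hγm : 9 * (2 * δ + 2 * (2 * m)) * (2 * m) ≤ m := by nlinarith
  have hZn : ‖bchLog A (-Sb)‖ ≤ 2 * (a + 2 * m) := norm_bchLog_le_two_mul ha (by rw [norm_neg]; exact hSbn) (by linarith)
  have h4 : ‖bchLog A (-Sb)‖ + ‖bchLog (bchLog Sb (-M)) Hb‖ ≤ 1 / 4 := by linarith
  have hstep := norm_bchLog_step_sub_mean_le (ι := Idx P) A
    (fun idx : Idx P => l (walkEnd (emb y) (stairWord idx.2.1 (off idx.1)))) (bchLog (bchLog Sb (-M)) Hb)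
    ha hb hm hG (by linarith)
  rw [← hSb, meanCLM_stairEnd_eq_siteAvg l y] at hstep
  have hδm : 0 ≤ δ * m := mul_nonneg hδ hm0
  have hmm : 0 ≤ m * m := mul_nonneg hm0 hm0
  have ham : 0 ≤ a * m := mul_nonneg ha0 hm0
  have hdev : ‖bchLog (bchLog A (-Sb)) (bchLog (bchLog Sb (-M)) Hb) - siteAvg l y‖ ≤ 160 * (a + δ + m) * m :=
    calc _ ≤ 12 * (a + m) * m + 2 * (9 * (2 * δ + 2 * (2 * m)) * (2 * m)) := hstep
      _ ≤ 160 * (a + δ + m) * m := by nlinarith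
  have havg : ‖siteAvg l y‖ ≤ a := by
    rw [← meanCLM_stairEnd_eq_siteAvg l y]; exact norm_meanCLM_le_of_forall_le _ ha0 hb
  refine ⟨bchLog (bchLog A (-Sb)) (bchLog (bchLog Sb (-M)) Hb), ?_, hdev, ?_⟩
  · rw [hkey, ← exp_bchLog (norm_expMul_sub_one_lt_one h1), ← exp_bchLog (norm_expMul_sub_one_lt_one h2),
      ← exp_bchLog (norm_expMul_sub_one_lt_one h3), ← exp_bchLog (norm_expMul_sub_one_lt_one h4)]
  · have h5 : 160 * (a + δ + m) * m ≤ 5 * m := by nlinarith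
    calc _ = ‖(bchLog (bchLog A (-Sb)) (bchLog (bchLog Sb (-M)) Hb) - siteAvg l y) + siteAvg l y‖ := by rw [sub_add_cancel]
      _ ≤ 160 * (a + δ + m) * m + a := (norm_add_le _ _).trans (add_le_add hdev havg)
      _ ≤ a + 5 * m := by linarith

/-- **★★ ONE STEP IN LOG COORDINATES — POINTWISE HYPOTHESES**: under the hypotheses of ✓`exists_effGauge_succ_eq_exp_pt`, `‖log κ_{i+1}(y) − siteAvg l y‖ ≤ 160·(a + δ + m)·m` (`log` = ✓`MatrixLog.mlog`; `mlog (exp Λ) = Λ` since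
`‖Λ‖ ≤ a + 5m < ln 2`). [cite: Balaban1985RegularSpaces, Sect. E (1.120)-(1.121) pp.95-96; Balaban1985Averaging, (110) p.34] -/
theorem norm_mlog_effGauge_succ_sub_siteAvg_le_pt [Nonempty (Idx P)] (W : GaugeField P 0 𝔸ˣ) (κ : (i : ℕ) → GaugeTransf P i 𝔸ˣ)
    (hs : ∀ (i : ℕ) (y : Site P (i + 1)),
      κ (i + 1) y = (vframeU (gaugeActT (κ i) (dbarIterU i W)) y)⁻¹ * κ i (emb y) * vframeU (dbarIterU i W) y)
    (i : ℕ) (y : Site P (i + 1)) (l : Site P i → 𝔸) (hκc : ((κ i (emb y) : 𝔸ˣ) : 𝔸) = exp (l (emb y)))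
    (hκs : ∀ idx : Idx P, ((κ i (walkEnd (emb y) (stairWord idx.2.1 (off idx.1))) : 𝔸ˣ) : 𝔸) =
      exp (l (walkEnd (emb y) (stairWord idx.2.1 (off idx.1))))) {δ a m : ℝ} (hδ : 0 ≤ δ)
    (hH : ∀ idx : Idx P, ‖((holT (dbarIterU i W) (emb y) (stairWord idx.2.1 (off idx.1)) : 𝔸ˣ) : 𝔸) - 1‖ ≤ δ)
    (ha : ‖l (emb y)‖ ≤ a) (hb : ∀ idx : Idx P, ‖l (walkEnd (emb y) (stairWord idx.2.1 (off idx.1)))‖ ≤ a)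
    (hm : ∀ idx : Idx P, ‖l (walkEnd (emb y) (stairWord idx.2.1 (off idx.1))) - l (emb y)‖ ≤ m)
    (hr : 2 * a + 4 * δ + 8 * m ≤ 1 / 16) :
    ‖mlog ((κ (i + 1) y : 𝔸ˣ) : 𝔸) - siteAvg l y‖ ≤ 160 * (a + δ + m) * m := by
  obtain ⟨Λ, hΛ, hdev, hΛn⟩ := exists_effGauge_succ_eq_exp_pt W κ hs i y l hκc hκs hδ hH ha hb hm hr
  have hm0 : 0 ≤ m := (norm_nonneg _).trans (hm (Classical.arbitrary (Idx P)))
  have hlt : ‖Λ‖ < Real.log 2 := by linarith [Real.log_two_gt_d9, norm_nonneg (l (emb y))]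
  rw [hΛ, B7BlockAvgLog.mlog_exp hlt]
  exact hdev

/-- **THE NEXT LEVEL'S GAUGE IS AGAIN `exp ∘ log`** (so the step iterates with `l_{i+1} := log ∘ κ_{i+1}`): `exp (mlog κ_{i+1}(y)) = κ_{i+1}(y)`
and `‖mlog κ_{i+1}(y)‖ ≤ a + 5m`, under the hypotheses of ✓`exists_effGauge_succ_eq_exp_pt`. [cite: Balaban1985Averaging, (97)-(100) p.32] -/
theorem exp_mlog_effGauge_succ_pt [Nonempty (Idx P)] (W : GaugeField P 0 𝔸ˣ) (κ : (i : ℕ) → GaugeTransf P i 𝔸ˣ)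
    (hs : ∀ (i : ℕ) (y : Site P (i + 1)),
      κ (i + 1) y = (vframeU (gaugeActT (κ i) (dbarIterU i W)) y)⁻¹ * κ i (emb y) * vframeU (dbarIterU i W) y)
    (i : ℕ) (y : Site P (i + 1)) (l : Site P i → 𝔸) (hκc : ((κ i (emb y) : 𝔸ˣ) : 𝔸) = exp (l (emb y)))
    (hκs : ∀ idx : Idx P, ((κ i (walkEnd (emb y) (stairWord idx.2.1 (off idx.1))) : 𝔸ˣ) : 𝔸) =
      exp (l (walkEnd (emb y) (stairWord idx.2.1 (off idx.1))))) {δ a m : ℝ} (hδ : 0 ≤ δ)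
    (hH : ∀ idx : Idx P, ‖((holT (dbarIterU i W) (emb y) (stairWord idx.2.1 (off idx.1)) : 𝔸ˣ) : 𝔸) - 1‖ ≤ δ)
    (ha : ‖l (emb y)‖ ≤ a) (hb : ∀ idx : Idx P, ‖l (walkEnd (emb y) (stairWord idx.2.1 (off idx.1)))‖ ≤ a)
    (hm : ∀ idx : Idx P, ‖l (walkEnd (emb y) (stairWord idx.2.1 (off idx.1))) - l (emb y)‖ ≤ m)
    (hr : 2 * a + 4 * δ + 8 * m ≤ 1 / 16) :
    exp (mlog ((κ (i + 1) y : 𝔸ˣ) : 𝔸)) = ((κ (i + 1) y : 𝔸ˣ) : 𝔸) ∧ ‖mlog ((κ (i + 1) y : 𝔸ˣ) : 𝔸)‖ ≤ a + 5 * m := by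
  obtain ⟨Λ, hΛ, -, hΛn⟩ := exists_effGauge_succ_eq_exp_pt W κ hs i y l hκc hκs hδ hH ha hb hm hr
  have hm0 : 0 ≤ m := (norm_nonneg _).trans (hm (Classical.arbitrary (Idx P)))
  have hlt : ‖Λ‖ < Real.log 2 := by linarith [Real.log_two_gt_d9, norm_nonneg (l (emb y))]
  rw [hΛ, B7BlockAvgLog.mlog_exp hlt]
  exact ⟨rfl, hΛn⟩

end Step

/-! ## §2 Sup bounds under the block site-average, on a closed family of site sets -/

section Sup

omit [CompleteSpace 𝔸] in
/-- **`Q′_j` PRESERVES SUP BOUNDS ON A STAIR-CLOSED FAMILY OF SITE SETS**: if the stair ends of every block in `S (j+1)` lie in `S j`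
(`j < k`) and `‖l₀‖ ≤ a` on `S 0`, then `‖Q′_j l₀‖ ≤ a` on `S j` for all `j ≤ k`. [cite: Balaban1984PropagatorsI, (1.20) p.20] -/
theorem norm_siteAvgIter_le_local (l₀ : Site P 0 → 𝔸) {a : ℝ} (ha0 : 0 ≤ a) (k : ℕ) (S : (j : ℕ) → Set (Site P j))
    (hSs : ∀ j < k, ∀ y ∈ S (j + 1), ∀ idx : Idx P, walkEnd (emb y) (stairWord idx.2.1 (off idx.1)) ∈ S j)
    (ha : ∀ x ∈ S 0, ‖l₀ x‖ ≤ a) : ∀ j ≤ k, ∀ y ∈ S j, ‖siteAvgIter j l₀ y‖ ≤ a := by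
  intro j
  induction j with
  | zero => intro _ y hy; exact ha y hy
  | succ j ih =>
    intro hjk y hy
    show ‖siteAvg (siteAvgIter j l₀) y‖ ≤ a
    exact norm_siteAvg_le (siteAvgIter j l₀) y ha0 fun idx =>
      ih (Nat.le_of_succ_le hjk) _ (hSs j (Nat.lt_of_succ_le hjk) y hy idx)

end Sup

/-! ## §3 The local tower: the `k`-uniform size row (1.121) with hypotheses on `S` only -/

section Tower

/-- **★★★ THE EFFECTIVE-GAUGE TOWER IN LOG COORDINATES, `k`-UNIFORM, LOCAL**: as ✓`exp_mlog_and_norm_mlog_effGauge_sub_siteAvgIter_le`,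
but every hypothesis (`‖l₀‖ ≤ a`, stairs within `δ` of `1`, linear oscillations `≤ ω·2^{j+1}/2^k`) is asked only on a family of site sets
`S j ⊆ T^{(j)}` closed under «the centre and the stair ends of a block of `S (j+1)` lie in `S j`» (`j < k`), and the conclusion
(`κ_j = exp ∘ log ∘ κ_j`, `‖log κ_j(y) − (Q′_j l₀)(y)‖ ≤ 4·160(a + δ + 5ω)·ω·2^j/2^k`) holds on `S j` — the form the (1.120)-box
hypotheses of the family contraction supply (take `S j` := the level-`j` sites under the box, or under the evaluation site).
[cite: Balaban1985RegularSpaces, Sect. E (1.120)-(1.121) pp.95-96; Balaban1985Averaging, (97)-(100) p.32, (110) p.34] -/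
theorem exp_mlog_and_norm_mlog_effGauge_sub_siteAvgIter_le_local [Nonempty (Idx P)] (W : GaugeField P 0 𝔸ˣ)
    (κ : (i : ℕ) → GaugeTransf P i 𝔸ˣ)
    (hs : ∀ (i : ℕ) (y : Site P (i + 1)),
      κ (i + 1) y = (vframeU (gaugeActT (κ i) (dbarIterU i W)) y)⁻¹ * κ i (emb y) * vframeU (dbarIterU i W) y)
    (l₀ : Site P 0 → 𝔸) (hκ0 : ∀ x, ((κ 0 x : 𝔸ˣ) : 𝔸) = exp (l₀ x)) {a δ ω : ℝ} (ha0 : 0 ≤ a) (hδ : 0 ≤ δ) (hω : 0 ≤ ω)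
    (k : ℕ) (S : (j : ℕ) → Set (Site P j))
    (hSe : ∀ j < k, ∀ y ∈ S (j + 1), emb y ∈ S j)
    (hSs : ∀ j < k, ∀ y ∈ S (j + 1), ∀ idx : Idx P, walkEnd (emb y) (stairWord idx.2.1 (off idx.1)) ∈ S j)
    (ha : ∀ x ∈ S 0, ‖l₀ x‖ ≤ a)
    (hH : ∀ j < k, ∀ y ∈ S (j + 1), ∀ idx : Idx P,
      ‖((holT (dbarIterU j W) (emb y) (stairWord idx.2.1 (off idx.1)) : 𝔸ˣ) : 𝔸) - 1‖ ≤ δ)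
    (hosc : ∀ j < k, ∀ y ∈ S (j + 1), ∀ idx : Idx P,
      ‖siteAvgIter j l₀ (walkEnd (emb y) (stairWord idx.2.1 (off idx.1))) - siteAvgIter j l₀ (emb y)‖ ≤ ω * 2 ^ (j + 1) / 2 ^ k)
    (hr : 160 * (a + δ + 5 * ω) ≤ 1 / 4) :
    ∀ j ≤ k, ∀ y ∈ S j, exp (mlog ((κ j y : 𝔸ˣ) : 𝔸)) = ((κ j y : 𝔸ˣ) : 𝔸) ∧
      ‖mlog ((κ j y : 𝔸ˣ) : 𝔸) - siteAvgIter j l₀ y‖ ≤ 4 * (160 * (a + δ + 5 * ω)) * ω * (2 ^ j / 2 ^ k) := by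
  set ε : ℝ := 160 * (a + δ + 5 * ω) with hε
  have hε0 : 0 ≤ ε := by positivity
  have h2k : (0 : ℝ) < 2 ^ k := by positivity
  intro j
  induction j with
  | zero =>
    intro _ y hy
    have hlt : ‖l₀ y‖ < Real.log 2 := by linarith [ha y hy, Real.log_two_gt_d9]
    refine ⟨by rw [hκ0, B7BlockAvgLog.mlog_exp hlt], ?_⟩
    rw [hκ0, B7BlockAvgLog.mlog_exp hlt]
    show ‖l₀ y - l₀ y‖ ≤ _
    rw [sub_self, norm_zero]; positivity
  | succ j ih =>
    intro hjk y hy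
    have hj : j < k := Nat.lt_of_succ_le hjk
    have ihj := ih hj.le
    have hye : emb y ∈ S j := hSe j hj y hy
    have hys : ∀ idx : Idx P, walkEnd (emb y) (stairWord idx.2.1 (off idx.1)) ∈ S j := hSs j hj y hy
    -- the geometric weights `t = 2^j/2^k ≤ 1/2`
    set t : ℝ := 2 ^ j / 2 ^ k with ht
    have ht0 : 0 ≤ t := by positivity
    have ht1 : t ≤ 1 := by
      rw [ht, div_le_one h2k]; exact pow_le_pow_right₀ (by norm_num) hj.le
    have ht2 : (2 : ℝ) ^ (j + 1) / 2 ^ k = 2 * t := by rw [ht, pow_succ]; ring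
    have ht2' : ω * 2 ^ (j + 1) / 2 ^ k = 2 * ω * t := by rw [ht, pow_succ]; ring
    -- level-`j` logs and their sizes on `S j`
    set l : Site P j → 𝔸 := fun x => mlog ((κ j x : 𝔸ˣ) : 𝔸) with hl
    have hκc : ((κ j (emb y) : 𝔸ˣ) : 𝔸) = exp (l (emb y)) := ((ihj _ hye).1).symm
    have hκs : ∀ idx : Idx P, ((κ j (walkEnd (emb y) (stairWord idx.2.1 (off idx.1))) : 𝔸ˣ) : 𝔸) =
        exp (l (walkEnd (emb y) (stairWord idx.2.1 (off idx.1)))) := fun idx => ((ihj _ (hys idx)).1).symm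
    set d : ℝ := 4 * ε * ω * t with hd
    have hd0 : 0 ≤ d := by positivity
    have hdev : ∀ x ∈ S j, ‖l x - siteAvgIter j l₀ x‖ ≤ d := fun x hx => (ihj x hx).2
    have hdω : d ≤ ω * t := by
      rw [hd]; nlinarith [mul_nonneg hω ht0]
    have hsize : ∀ x ∈ S j, ‖l x‖ ≤ a + d := fun x hx =>
      calc ‖l x‖ = ‖(l x - siteAvgIter j l₀ x) + siteAvgIter j l₀ x‖ := by rw [sub_add_cancel]
        _ ≤ d + a := (norm_add_le _ _).trans (add_le_add (hdev x hx) (norm_siteAvgIter_le_local l₀ ha0 k S hSs ha j hj.le x hx))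
        _ = a + d := add_comm _ _
    have hoscl : ∀ idx : Idx P, ‖l (walkEnd (emb y) (stairWord idx.2.1 (off idx.1))) - l (emb y)‖ ≤ ω * 2 ^ (j + 1) / 2 ^ k + 2 * d := by
      intro idx
      have e1 := hdev (walkEnd (emb y) (stairWord idx.2.1 (off idx.1))) (hys idx)
      have e2 := hdev (emb y) hye
      have e3 := hosc j hj y hy idx
      calc _ = ‖(l (walkEnd (emb y) (stairWord idx.2.1 (off idx.1))) - siteAvgIter j l₀ (walkEnd (emb y) (stairWord idx.2.1 (off idx.1))))
            + (siteAvgIter j l₀ (walkEnd (emb y) (stairWord idx.2.1 (off idx.1))) - siteAvgIter j l₀ (emb y))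
            - (l (emb y) - siteAvgIter j l₀ (emb y))‖ := by congr 1; abel
        _ ≤ d + ω * 2 ^ (j + 1) / 2 ^ k + d := by
            refine (norm_sub_le _ _).trans (add_le_add ((norm_add_le _ _).trans (add_le_add e1 e3)) e2)
        _ = _ := by ring
    have hm0 : 0 ≤ ω * 2 ^ (j + 1) / 2 ^ k := by positivity
    -- the smallness of the step at this level
    have hrj : 2 * (a + d) + 4 * δ + 8 * (ω * 2 ^ (j + 1) / 2 ^ k + 2 * d) ≤ 1 / 16 := by
      rw [ht2']; nlinarith [mul_nonneg hω ht0]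
    have hstep := norm_mlog_effGauge_succ_sub_siteAvg_le_pt W κ hs j y l hκc hκs hδ (hH j hj y hy) (hsize _ hye)
      (fun idx => hsize _ (hys idx)) hoscl hrj
    have hexp := exp_mlog_effGauge_succ_pt W κ hs j y l hκc hκs hδ (hH j hj y hy) (hsize _ hye) (fun idx => hsize _ (hys idx))
      hoscl hrj
    refine ⟨hexp.1, ?_⟩
    -- deviation at level `j+1`: step error + averaged deviation of level `j`
    have havg : ‖siteAvg l y - siteAvgIter (j + 1) l₀ y‖ ≤ d := by
      show ‖siteAvg l y - siteAvg (siteAvgIter j l₀) y‖ ≤ d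
      exact norm_siteAvg_sub_siteAvg_le _ _ y hd0 fun idx => hdev _ (hys idx)
    have harith := step_arith ha0 hδ hω ht0 ht1 hd0 (le_of_eq hd) hm0 (le_of_eq ht2') hr
    calc ‖mlog ((κ (j + 1) y : 𝔸ˣ) : 𝔸) - siteAvgIter (j + 1) l₀ y‖
        = ‖(mlog ((κ (j + 1) y : 𝔸ˣ) : 𝔸) - siteAvg l y) + (siteAvg l y - siteAvgIter (j + 1) l₀ y)‖ := by rw [sub_add_sub_cancel]
      _ ≤ 160 * (a + d + δ + (ω * 2 ^ (j + 1) / 2 ^ k + 2 * d)) * (ω * 2 ^ (j + 1) / 2 ^ k + 2 * d) + d :=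
          (norm_add_le _ _).trans (add_le_add hstep havg)
      _ ≤ 4 * ε * ω * (2 * t) := harith
      _ = 4 * (160 * (a + δ + 5 * ω)) * ω * (2 ^ (j + 1) / 2 ^ k) := by rw [hε, ht2]

/-- **★★★ THE TOP-LEVEL SIZE ROW (1.121), `k`-UNIFORM, LOCAL**: under the hypotheses of
✓`exp_mlog_and_norm_mlog_effGauge_sub_siteAvgIter_le_local`, for every `y ∈ S k`:
`κ_k(y) = e^{log κ_k(y)}` and `‖log κ_k(y) − (Q′_k l₀)(y)‖ ≤ 640·(a + δ + 5ω)·ω` — constant independent of `k`, data read on `S` only.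
[cite: Balaban1985RegularSpaces, Sect. E (1.121) p.96] -/
theorem norm_mlog_effGauge_top_sub_siteAvgIter_le_local [Nonempty (Idx P)] (W : GaugeField P 0 𝔸ˣ)
    (κ : (i : ℕ) → GaugeTransf P i 𝔸ˣ)
    (hs : ∀ (i : ℕ) (y : Site P (i + 1)),
      κ (i + 1) y = (vframeU (gaugeActT (κ i) (dbarIterU i W)) y)⁻¹ * κ i (emb y) * vframeU (dbarIterU i W) y)
    (l₀ : Site P 0 → 𝔸) (hκ0 : ∀ x, ((κ 0 x : 𝔸ˣ) : 𝔸) = exp (l₀ x)) {a δ ω : ℝ} (ha0 : 0 ≤ a) (hδ : 0 ≤ δ) (hω : 0 ≤ ω)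
    (k : ℕ) (S : (j : ℕ) → Set (Site P j))
    (hSe : ∀ j < k, ∀ y ∈ S (j + 1), emb y ∈ S j)
    (hSs : ∀ j < k, ∀ y ∈ S (j + 1), ∀ idx : Idx P, walkEnd (emb y) (stairWord idx.2.1 (off idx.1)) ∈ S j)
    (ha : ∀ x ∈ S 0, ‖l₀ x‖ ≤ a)
    (hH : ∀ j < k, ∀ y ∈ S (j + 1), ∀ idx : Idx P,
      ‖((holT (dbarIterU j W) (emb y) (stairWord idx.2.1 (off idx.1)) : 𝔸ˣ) : 𝔸) - 1‖ ≤ δ)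
    (hosc : ∀ j < k, ∀ y ∈ S (j + 1), ∀ idx : Idx P,
      ‖siteAvgIter j l₀ (walkEnd (emb y) (stairWord idx.2.1 (off idx.1))) - siteAvgIter j l₀ (emb y)‖ ≤ ω * 2 ^ (j + 1) / 2 ^ k)
    (hr : 160 * (a + δ + 5 * ω) ≤ 1 / 4) (y : Site P k) (hy : y ∈ S k) :
    exp (mlog ((κ k y : 𝔸ˣ) : 𝔸)) = ((κ k y : 𝔸ˣ) : 𝔸) ∧ ‖mlog ((κ k y : 𝔸ˣ) : 𝔸) - siteAvgIter k l₀ y‖ ≤ 640 * (a + δ + 5 * ω) * ω := by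
  have h := exp_mlog_and_norm_mlog_effGauge_sub_siteAvgIter_le_local W κ hs l₀ hκ0 ha0 hδ hω k S hSe hSs ha hH hosc hr k le_rfl y hy
  have h2k : (2 : ℝ) ^ k / 2 ^ k = 1 := div_self (by positivity)
  rw [h2k] at h
  refine ⟨h.1, h.2.trans (le_of_eq (by ring))⟩

end Tower

end Summit.QuantumFields.YangMills.Theorems.P1FlatCoreFrameLinLocal

end
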